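import Mathlib
import HarnessLib
import Literature.MathematicalPhysics.QuantumLattice.FermiRG.FST2FermiCurveParam
import Summits.HubbardSuperconductivity.HubbardSuperconductivity.Theorems.KLProgrammeFermiSurfaceFST2
import Summits.HubbardSuperconductivity.HubbardSuperconductivity.Theorems.KLProgrammeFermiSurfaceFST2Regularity
import Summits.HubbardSuperconductivity.HubbardSuperconductivity.Theorems.KLProgrammeFermiSurfaceFST2Global

/-!
# Route `KLProgramme` — risk-register item r2: FST II §2.2's ANGULAR COORDINATE and the UNIQUE ANTIPODE for the free Hubbard band
# (census row for t4 g5's `FermiRG/FST2FermiCurveParam.lean`, every `-4 < μ < 0`, hence on every window)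

Cell `gate-hubbard-kl`, seat fs-1 (g7). Typer t4 (g5, p459304 + rev 2) built the `d = 2` angular coordinate of FST II §2.2
(p.9 L40–71) — a `2π`-periodic constant-speed `C^k` parametrisation `θ ↦ p(0,θ)` of `S ∩ F`, the datum `FermiCurveParam cr e`
over which (A4′)/`antipodeAngularDeriv` are typed — from (A2)_{k,h} (`k ≥ 1`) and the global half of (A3)
(`exists_fermiCurveParam_contDiff`), together with existence and UNIQUENESS of the antipode in `d = 2` without the filling
condition (A5) (`exists_isAntipodalMapOn`, `eq_of_isAntipode_of_isAntipode`). The fs-1 lineage proved the inputs for the Hubbard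
datum `e = ε - μ` on `Crystal.cubic 2` at every `-4 < μ < 0`: `klfs_hypA2` (all `k`, `h = 0`), `klfs_hypA3`, `klfs_hypA3Global`
(`S ∩ F = ∂C_μ`, `C_μ` the compact strictly convex sea body), and the explicit antipodal map `a = -id`
(`klfs_isAntipodalMapOn_neg`). This file composes them (FS-WINDOW.md §5 census, new row «FST II §2.2 angular coordinate»):

* `klfs_finrank_momentum` : `finrank ℝ Momentum = 2`;
* `klfs_exists_fermiCurveParam_contDiff` : for every `-4 < μ < 0` and every `k ≥ 1` the free Fermi curve `{ε = μ} ∩ [-π,π)²` has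
  a `FermiCurveParam` whose curve is `C^k` (the band is real-analytic, so ALL `k`); `klfs_nonempty_fermiCurveParam`;
* `klfs_antipode_eq_neg` : **the antipode is unique and equals `-p`**: if `p, q ∈ S ∩ F` and `n(q) = -n(p)` then `q = -p` — FST II
  p.7 L70 «for symmetric `e`, `a(p) = -p`» as a theorem for the Hubbard band (= the Gauss-map form of «no nesting»: the only
  point of the Fermi curve with unit normal opposite to `n(p)` is `-p`; cf. `klfs_parallel_gradients`);
  `klfs_antipodalMapOn_eq_neg` : every antipodal map of `S ∩ F` agrees with `-id` on `S ∩ F`;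
* `klfs_windows_fermiCurveParam` : the rows on the programme's windows (`[-0.4275,-0.1775]`, `[-1,-0.15]`, `[-0.5725,-0.075]`).

No definitions; everything PROVED (compositions). [folklore]
-/

noncomputable section

open Real Set

-- the tree's namespace `Summit.<Summit>.<Problem>.Theorems` repeats the summit name by design (D-0017)
set_option linter.dupNamespace false

namespace Summit.HubbardSuperconductivity.HubbardSuperconductivity.Theorems

open Literature.MathematicalPhysics.QuantumLattice
open Literature.MathematicalPhysics.QuantumLattice.FermiRG

/-! ### §1 The angular coordinate of FST II §2.2 for the Hubbard band -/

/-- Momentum space `EuclideanSpace ℝ (Fin 2)` is two-dimensional (`d = 2`, the hypothesis of every §2.2 statement). [folklore] -/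
theorem klfs_finrank_momentum : Module.finrank ℝ Momentum = 2 :=
  finrank_euclideanSpace_fin

/-- **FST II §2.2's angular coordinate EXISTS and is `C^k` for the free Hubbard band, every `k ≥ 1` and every `-4 < μ < 0`**:
there is a `FermiCurveParam (Crystal.cubic 2) (ε - μ)` — a `2π`-periodic parametrisation `θ ↦ p(0,θ)` of the Fermi curve
`{ε = μ} ∩ [-π,π)²`, injective on a period, of constant speed `1/P` — whose curve is `C^k` with continuous velocity `dγ = γ'`
(t4's `exists_fermiCurveParam_contDiff` on `klfs_hypA2` + `klfs_hypA3Global`). [folklore] -/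
theorem klfs_exists_fermiCurveParam_contDiff {μ : ℝ} (hμ₁ : -4 < μ) (hμ₂ : μ < 0) {k : ℕ} (hk : 1 ≤ k) :
    ∃ Θ : FermiCurveParam (Crystal.cubic 2) (fun q : Momentum => squareDispersion 1 0 q - μ),
      ContDiff ℝ k Θ.γ ∧ Continuous Θ.dγ ∧ ∀ θ, Θ.dγ θ = deriv Θ.γ θ :=
  exists_fermiCurveParam_contDiff (Crystal.cubic 2) klfs_finrank_momentum hk (klfs_hypA2 hμ₁ hμ₂ k)
    (klfs_hypA3Global hμ₁ hμ₂)

/-- The datum `FermiCurveParam (Crystal.cubic 2) (ε - μ)` of (A4′) is inhabited for every `-4 < μ < 0`. [folklore] -/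
theorem klfs_nonempty_fermiCurveParam {μ : ℝ} (hμ₁ : -4 < μ) (hμ₂ : μ < 0) :
    Nonempty (FermiCurveParam (Crystal.cubic 2) (fun q : Momentum => squareDispersion 1 0 q - μ)) :=
  nonempty_fermiCurveParam (Crystal.cubic 2) klfs_finrank_momentum le_rfl (klfs_hypA2 hμ₁ hμ₂ 1)
    (klfs_hypA3Global hμ₁ hμ₂)

/-! ### §2 The antipode of the Hubbard Fermi curve is unique and equals `-p` -/

/-- **Uniqueness of the antipode for the Hubbard band: `a(p) = -p`** (every `-4 < μ < 0`): if `p` and `q` lie on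
`S ∩ F = {ε = μ} ∩ [-π,π)²` and the unit normals are opposite, `n(q) = -n(p)`, then `q = -p` (t4's `d = 2` uniqueness
`eq_of_isAntipode_of_isAntipode` on the strictly convex sea body of `klfs_hypA3Global`, compared with the explicit antipode
`-p` of `klfs_isAntipodalMapOn_neg`). FST II p.7 L70 for the square lattice; no filling condition. [folklore] -/
theorem klfs_antipode_eq_neg {μ : ℝ} (hμ₁ : -4 < μ) (hμ₂ : μ < 0) {p q : Momentum}
    (hp : p ∈ (Crystal.cubic 2).fermiSurfaceRep (fun x : Momentum => squareDispersion 1 0 x - μ))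
    (hq : q ∈ (Crystal.cubic 2).fermiSurfaceRep (fun x : Momentum => squareDispersion 1 0 x - μ))
    (h : IsAntipode (fun x : Momentum => squareDispersion 1 0 x - μ) p q) : q = -p := by
  obtain ⟨C, hC, hsc, hint, hSF⟩ := klfs_hypA3Global hμ₁ hμ₂
  have he : ContDiff ℝ 2 (fun x : Momentum => squareDispersion 1 0 x - μ) := klfs_contDiff_e μ
  have hS : ∀ z ∈ frontier C, (fun x : Momentum => squareDispersion 1 0 x - μ) z = 0 := fun z hz => by
    rw [← hSF] at hz
    exact hz.1
  have hgrad : ∀ z ∈ frontier C, gradient (fun x : Momentum => squareDispersion 1 0 x - μ) z ≠ 0 := fun z hz =>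
    (klfs_hypA2 hμ₁ hμ₂ 2).gradient_ne_zero z (hS z hz)
  have hA3 := klfs_hypA3 hμ₁ hμ₂
  have hneg := klfs_isAntipodalMapOn_neg hμ₂ p hp
  have hq' : q ∈ frontier C := hSF ▸ hq
  have hnp' : -p ∈ frontier C := hSF ▸ hneg.1
  exact eq_of_isAntipode_of_isAntipode klfs_finrank_momentum hC hsc hint he hS hgrad (fun z hz => hA3 z (hS z hz))
    hq' hnp' h hneg.2

/-- **Every antipodal map of the Hubbard Fermi curve is `-id` there**: if `a` maps `S ∩ F` to itself with `n(a p) = -n(p)`, then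
`a p = -p` for all `p ∈ S ∩ F` (`-4 < μ < 0`). In particular the `∃ a` of FST II's (A4) (`klfs_hypA4`) is uniquely
witnessed. [folklore] -/
theorem klfs_antipodalMapOn_eq_neg {μ : ℝ} (hμ₁ : -4 < μ) (hμ₂ : μ < 0) {a : Momentum → Momentum}
    (ha : IsAntipodalMapOn (fun x : Momentum => squareDispersion 1 0 x - μ)
      ((Crystal.cubic 2).fermiSurfaceRep (fun x : Momentum => squareDispersion 1 0 x - μ)) a)
    {p : Momentum} (hp : p ∈ (Crystal.cubic 2).fermiSurfaceRep (fun x : Momentum => squareDispersion 1 0 x - μ)) :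
    a p = -p :=
  klfs_antipode_eq_neg hμ₁ hμ₂ hp (ha p hp).1 (ha p hp).2

/-- There IS an antipodal map of the Hubbard Fermi curve (abstractly from t4's `exists_isAntipodalMapOn`, `k = 2`; concretely
`-id`, `klfs_isAntipodalMapOn_neg`), and it is an involution on `S ∩ F`. [folklore] -/
theorem klfs_exists_isAntipodalMapOn_involutive {μ : ℝ} (hμ₁ : -4 < μ) (hμ₂ : μ < 0) :
    ∃ a : Momentum → Momentum,
      IsAntipodalMapOn (fun x : Momentum => squareDispersion 1 0 x - μ)
        ((Crystal.cubic 2).fermiSurfaceRep (fun x : Momentum => squareDispersion 1 0 x - μ)) a ∧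
      ∀ p ∈ (Crystal.cubic 2).fermiSurfaceRep (fun x : Momentum => squareDispersion 1 0 x - μ), a (a p) = p := by
  obtain ⟨a, ha⟩ := exists_isAntipodalMapOn klfs_finrank_momentum le_rfl (klfs_hypA2 hμ₁ hμ₂ 2) (klfs_hypA3 hμ₁ hμ₂)
    (klfs_hypA3Global hμ₁ hμ₂)
  exact ⟨a, ha, fun p hp => IsAntipodalMapOn.apply_apply_of_finrank_eq_two klfs_finrank_momentum le_rfl
    (klfs_hypA2 hμ₁ hμ₂ 2) (klfs_hypA3 hμ₁ hμ₂) (klfs_hypA3Global hμ₁ hμ₂) ha hp⟩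

/-! ### §3 On the programme's windows -/

/-- **FST II §2.2 on the windows**: at every level of the doping window of record `[-0.4275, -0.1775]`, of the analysis window
`[-1, -0.15]` and of the extended certificate window `[-0.5725, -0.075]`, the free Hubbard Fermi curve has a `C^k` angular
coordinate for every `k ≥ 1`, and its antipodal map is `-id`. [folklore] -/
theorem klfs_windows_fermiCurveParam {μ : ℝ}
    (hμ : μ ∈ Icc (-0.4275 : ℝ) (-0.1775) ∨ μ ∈ Icc (-1 : ℝ) (-0.15) ∨ μ ∈ Icc (-0.5725 : ℝ) (-0.075)) :
    (∀ k : ℕ, 1 ≤ k → ∃ Θ : FermiCurveParam (Crystal.cubic 2) (fun q : Momentum => squareDispersion 1 0 q - μ),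
      ContDiff ℝ k Θ.γ ∧ Continuous Θ.dγ ∧ ∀ θ, Θ.dγ θ = deriv Θ.γ θ) ∧
    (∀ a : Momentum → Momentum,
      IsAntipodalMapOn (fun x : Momentum => squareDispersion 1 0 x - μ)
        ((Crystal.cubic 2).fermiSurfaceRep (fun x : Momentum => squareDispersion 1 0 x - μ)) a →
      ∀ p ∈ (Crystal.cubic 2).fermiSurfaceRep (fun x : Momentum => squareDispersion 1 0 x - μ), a p = -p) := by
  have hμ₁ : -4 < μ := by rcases hμ with h | h | h <;> linarith [h.1]
  have hμ₂ : μ < 0 := by rcases hμ with h | h | h <;> linarith [h.2]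
  exact ⟨fun k hk => klfs_exists_fermiCurveParam_contDiff hμ₁ hμ₂ hk,
    fun a ha p hp => klfs_antipodalMapOn_eq_neg hμ₁ hμ₂ ha hp⟩

/-! ### §4 Orientation: the Fermi sea lies on the inner side of every tangent line (appended, fs-1 g7) -/

/-- **The free Fermi sea is on the inner side of every tangent line of the Fermi curve** (every `-4 < μ < 0`): for `x` on
`S ∩ F = {ε = μ} ∩ [-π,π)²` and every `y` of the sea body `C_μ = {|y₀| + |y₁| ≤ π, cos y₀ + cos y₁ ≥ -μ/2}` (`∂C_μ = S ∩ F`,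
`klfs_frontier_seaBody`), `⟨∇ε(x), y - x⟩ ≤ 0` — `∇e` points OUT of the sea, the orientation in which FST II fixes the sign of
(frene) (t4's `HypA3.inner_gradient_sub_nonpos` on `klfs_hypA2`/`klfs_hypA3` and fs-1 g2's sea body). [folklore] -/
theorem klfs_inner_gradient_sub_nonpos {μ : ℝ} (hμ₁ : -4 < μ) (hμ₂ : μ < 0) {x y : Momentum}
    (hx : x ∈ (Crystal.cubic 2).fermiSurfaceRep (fun q : Momentum => squareDispersion 1 0 q - μ))
    (hy : |y 0| + |y 1| ≤ π ∧ -μ / 2 ≤ Real.cos (y 0) + Real.cos (y 1)) :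
    inner ℝ (gradient (fun q : Momentum => squareDispersion 1 0 q - μ) x) (y - x) ≤ 0 :=
  HypA3.inner_gradient_sub_nonpos klfs_finrank_momentum le_rfl (klfs_hypA2 hμ₁ hμ₂ 2) (klfs_hypA3 hμ₁ hμ₂)
    (klfs_isCompact_seaBody μ) (klfs_strictConvex_seaBody hμ₂).convex ⟨0, klfs_zero_mem_interior_seaBody hμ₁⟩
    (klfs_frontier_seaBody hμ₁ hμ₂) hx (show y ∈ {p : Momentum | |p 0| + |p 1| ≤ π ∧
      -μ / 2 ≤ Real.cos (p 0) + Real.cos (p 1)} from hy)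

/-- In particular (take `y = 0`): **`⟨∇ε(x), x⟩ ≥ 0` on the Fermi curve** — the gradient makes an angle `≤ π/2` with the position
vector (fs-1 g4's sharper `cos ∠(∇ε, p) ≥ 1/√2` is in `…SharpCurvature.lean`). [folklore] -/
theorem klfs_inner_gradient_self_nonneg {μ : ℝ} (hμ₁ : -4 < μ) (hμ₂ : μ < 0) {x : Momentum}
    (hx : x ∈ (Crystal.cubic 2).fermiSurfaceRep (fun q : Momentum => squareDispersion 1 0 q - μ)) :
    0 ≤ inner ℝ (gradient (fun q : Momentum => squareDispersion 1 0 q - μ) x) x := by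
  have h := klfs_inner_gradient_sub_nonpos hμ₁ hμ₂ hx (y := 0)
    ⟨by simp [Real.pi_pos.le], by simp; linarith⟩
  rwa [zero_sub, inner_neg_right, neg_nonpos] at h

/-! ### §5 (curvratio) `∂a/∂θ ≡ 1` and FST II's asymmetric hypothesis (A4′) FAILS for the Hubbard band (appended, fs-1 g8)

Typer t4's revs 4–5 (`FermiCurveParam.inv_norm_mul_norm_deriv_antipode_eq`, `HypSy.hypA4`) identified the (A4) quantity
`|∂_θ p|⁻¹ |∂_θ a(p(0,θ))|` with the curvature ratio `∂a/∂θ = κ(θ)/κ(a(θ)) = antipodeAngularDeriv e a Θ θ` over which (A4′)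
(`HypA4'`, [II] §2.3 p.9 L127–139) is typed. For the free band the antipode is `-p` (§2) and the curvature is even, so the
ratio is IDENTICALLY `1`; (A4′) asks the zero set of `∂a/∂θ - 1` in a period to be FINITE, hence it is violated — exactly as
[II] p.9 L140–149 intends («(A4′) is imposed for `d = 2` and `e` not obeying (Sy)»; for symmetric `e` Theorem 1.3 (ii) is proved
from (Sy) instead). This completes the census of FS-WINDOW.md §5 for FST II: (A2) ✓, (A3) ✓, (Sy) ✓, (A4) ✓, (A4′) ✗, (A5) ✗ at
every `-4 < μ < 0` — a consumer of FST II/III on the Hubbard band must take the (Sy) branch, never the (A4′)/(H4′) branch. -/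

/-- **The curvature of the free Fermi curve is even**: `κ(-p) = κ(p)` for the tree's `levelCurvature` of `e = ε - μ` (every `μ`,
every `p`) — the gradient is odd (t4's `HypSy.gradient_neg` on `klfs_hypSy`) and the Hessian form `2(cos p₀ v₀² + cos p₁ v₁²)`
(`klfs_hessQuad_e`) is even in `p`. [folklore] -/
theorem klfs_levelCurvature_neg (μ : ℝ) (p : Momentum) :
    levelCurvature (fun q : Momentum => squareDispersion 1 0 q - μ) (-p) =
      levelCurvature (fun q : Momentum => squareDispersion 1 0 q - μ) p := by
  have hg : gradient (fun q : Momentum => squareDispersion 1 0 q - μ) (-p) =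
      -gradient (fun q : Momentum => squareDispersion 1 0 q - μ) p := (klfs_hypSy μ).gradient_neg p
  have hh : ∀ v : Momentum, hessQuad (fun q : Momentum => squareDispersion 1 0 q - μ) (-p) v =
      hessQuad (fun q : Momentum => squareDispersion 1 0 q - μ) p v := fun v => by
    rw [klfs_hessQuad_e, klfs_hessQuad_e]
    simp [Real.cos_neg]
  unfold levelCurvature
  simp_rw [hh, hg, norm_neg, inner_neg_left, neg_eq_zero]

/-- **The curvature of the free Fermi curve is strictly positive at every point of an angular coordinate** (`-4 < μ < 0`):
`0 < κ(p(0,θ))` for every `FermiCurveParam` `Θ` and every `θ` — [II] Lemma 2.1's first display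
(`FermiCurveParam.levelCurvature_mul_norm_gradient`: `κ |∇e| = P² (∂_θ p, e'' ∂_θ p)`) with (A3) (`klfs_hypA3`:
`(∂_θ p, e'' ∂_θ p) > 0`, `∂_θ p ⊥ ∇e`, `|∂_θ p| = 1/P ≠ 0`) and (A2) (`∇e ≠ 0` on `S`). [folklore] -/
theorem klfs_levelCurvature_pos {μ : ℝ} (hμ₁ : -4 < μ) (hμ₂ : μ < 0)
    (Θ : FermiCurveParam (Crystal.cubic 2) (fun q : Momentum => squareDispersion 1 0 q - μ)) (θ : ℝ) :
    0 < levelCurvature (fun q : Momentum => squareDispersion 1 0 q - μ) (Θ.γ θ) := by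
  have hp : Θ.γ θ ∈ fermiSurface (fun q : Momentum => squareDispersion 1 0 q - μ) := (Θ.mem θ).1
  have hgrad : gradient (fun q : Momentum => squareDispersion 1 0 q - μ) (Θ.γ θ) ≠ 0 :=
    (klfs_hypA2 hμ₁ hμ₂ 2).gradient_ne_zero _ hp
  have hdiff : DifferentiableAt ℝ (fun q : Momentum => squareDispersion 1 0 q - μ) (Θ.γ θ) :=
    ((klfs_contDiff_e μ (n := 1)).differentiable one_ne_zero).differentiableAt
  have hkey := Θ.levelCurvature_mul_norm_gradient klfs_finrank_momentum hdiff hgrad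
  have horth : inner ℝ (gradient (fun q : Momentum => squareDispersion 1 0 q - μ) (Θ.γ θ)) (Θ.dγ θ) = 0 :=
    inner_gradient_eq_zero_of_apply_comp_eq_zero hdiff (Θ.hasDerivAt θ) fun t => (Θ.mem t).1
  have hdγ0 : Θ.dγ θ ≠ 0 := by
    intro h0
    have h1 := Θ.norm_dγ θ
    rw [h0, norm_zero] at h1
    exact (inv_pos.2 Θ.P_pos).ne h1
  have hhess : 0 < hessQuad (fun q : Momentum => squareDispersion 1 0 q - μ) (Θ.γ θ) (Θ.dγ θ) :=
    klfs_hypA3 hμ₁ hμ₂ _ hp _ hdγ0 horth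
  have hnorm : 0 < ‖gradient (fun q : Momentum => squareDispersion 1 0 q - μ) (Θ.γ θ)‖ := norm_pos_iff.2 hgrad
  have hprod : 0 < levelCurvature (fun q : Momentum => squareDispersion 1 0 q - μ) (Θ.γ θ) *
      ‖gradient (fun q : Momentum => squareDispersion 1 0 q - μ) (Θ.γ θ)‖ := by
    rw [hkey]; exact mul_pos (pow_pos Θ.P_pos 2) hhess
  exact (mul_pos_iff_of_pos_right hnorm).1 hprod

/-- **(curvratio) `∂a/∂θ ≡ 1` for the free Hubbard band** (every `-4 < μ < 0`): for EVERY angular coordinate `Θ` of FST II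
§2.2 and EVERY antipodal map `a` of `S ∩ F`, the curvature ratio `∂a/∂θ = κ(θ)/κ(a(θ))` ([II] eq. (curvratio) p.9 L117–123,
the tree's `antipodeAngularDeriv`) equals `1` at every `θ` — `a = -id` on `S ∩ F` (`klfs_antipodalMapOn_eq_neg`), `κ` is even
(`klfs_levelCurvature_neg`) and non-zero (`klfs_levelCurvature_pos`). By t4's `FermiCurveParam.inv_norm_mul_norm_deriv_antipode_eq`
this is the same statement as «the left-hand side of (upplo) vanishes» (`klfs_hypA4`). [folklore] -/
theorem klfs_antipodeAngularDeriv_eq_one {μ : ℝ} (hμ₁ : -4 < μ) (hμ₂ : μ < 0)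
    (Θ : FermiCurveParam (Crystal.cubic 2) (fun q : Momentum => squareDispersion 1 0 q - μ)) {a : Momentum → Momentum}
    (ha : IsAntipodalMapOn (fun x : Momentum => squareDispersion 1 0 x - μ)
      ((Crystal.cubic 2).fermiSurfaceRep (fun x : Momentum => squareDispersion 1 0 x - μ)) a) (θ : ℝ) :
    antipodeAngularDeriv (fun q : Momentum => squareDispersion 1 0 q - μ) a Θ θ = 1 := by
  unfold antipodeAngularDeriv
  rw [klfs_antipodalMapOn_eq_neg hμ₁ hμ₂ ha (Θ.mem θ), klfs_levelCurvature_neg]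
  exact div_self (klfs_levelCurvature_pos hμ₁ hμ₂ Θ θ).ne'

/-- [II] p.9 L140–149 as a lemma (any `E`, any crystal, any `e`, `a`, `Θ`): **if `∂a/∂θ ≡ 1` then (A4′) fails** — (A4′)
(`HypA4'`) requires the set of `θ` in a period with `∂a/∂θ = 1` to be a FINITE set `Z`, but here it is the whole (infinite)
period `[0, 2π)`. [cite: FeldmanSalmhoferTrubowitz1998, §2.3 (arXiv p.9 L127–149)] -/
theorem klfs_not_hypA4'_of_forall_eq_one {E : Type*} [NormedAddCommGroup E] [InnerProductSpace ℝ E] [CompleteSpace E]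
    {cr : Crystal E} {e : E → ℝ} {a : E → E} {Θ : FermiCurveParam cr e}
    (h : ∀ θ : ℝ, antipodeAngularDeriv e a Θ θ = 1) : ¬ HypA4' e a Θ := by
  rintro ⟨Z, -, hZ, -⟩
  have hsub : Ico (0 : ℝ) (2 * π) ⊆ (↑Z : Set ℝ) := fun θ hθ => (hZ θ hθ).1 (h θ)
  exact Ico_infinite (by positivity : (0 : ℝ) < 2 * π) (Z.finite_toSet.subset hsub)

/-- **FST II's asymmetric hypothesis (A4′) is FALSE for the free Hubbard band** at every `-4 < μ < 0`, for EVERY angular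
coordinate `Θ` and EVERY antipodal map `a` of `S ∩ F`: `∂a/∂θ ≡ 1` (`klfs_antipodeAngularDeriv_eq_one`), so its zero set
`{θ ∈ [0,2π) : ∂a/∂θ = 1}` is the whole period, not a finite set. Census reading: (A4′) is [II]'s hypothesis «for `d = 2` and `e`
not obeying (Sy)» (p.9 L127) — the Hubbard band obeys (Sy) (`klfs_hypSy`) and (A4) (`klfs_hypA4`), and any use of FST II
Theorem 1.3 (ii) / FST III Theorem 1.1 (ii) for it must go through the symmetric branch. [folklore] -/
theorem klfs_not_hypA4' {μ : ℝ} (hμ₁ : -4 < μ) (hμ₂ : μ < 0)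
    (Θ : FermiCurveParam (Crystal.cubic 2) (fun q : Momentum => squareDispersion 1 0 q - μ)) {a : Momentum → Momentum}
    (ha : IsAntipodalMapOn (fun x : Momentum => squareDispersion 1 0 x - μ)
      ((Crystal.cubic 2).fermiSurfaceRep (fun x : Momentum => squareDispersion 1 0 x - μ)) a) :
    ¬ HypA4' (fun q : Momentum => squareDispersion 1 0 q - μ) a Θ :=
  klfs_not_hypA4'_of_forall_eq_one fun θ => klfs_antipodeAngularDeriv_eq_one hμ₁ hμ₂ Θ ha θ

/-- The (Sy)/(A4)/(A4′) census in ONE statement (every `-4 < μ < 0`): the band is symmetric, (A4) holds, angular coordinates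
and antipodal maps EXIST (so the following is not vacuous), and for every such pair `∂a/∂θ ≡ 1` and (A4′) fails. [folklore] -/
theorem klfs_sy_hypA4_not_hypA4' {μ : ℝ} (hμ₁ : -4 < μ) (hμ₂ : μ < 0) :
    HypSy (fun q : Momentum => squareDispersion 1 0 q - μ) ∧
    HypA4 (Crystal.cubic 2) (fun q : Momentum => squareDispersion 1 0 q - μ) ∧
    Nonempty (FermiCurveParam (Crystal.cubic 2) (fun q : Momentum => squareDispersion 1 0 q - μ)) ∧
    (∃ a : Momentum → Momentum, IsAntipodalMapOn (fun x : Momentum => squareDispersion 1 0 x - μ)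
      ((Crystal.cubic 2).fermiSurfaceRep (fun x : Momentum => squareDispersion 1 0 x - μ)) a) ∧
    ∀ (Θ : FermiCurveParam (Crystal.cubic 2) (fun q : Momentum => squareDispersion 1 0 q - μ)) (a : Momentum → Momentum),
      IsAntipodalMapOn (fun x : Momentum => squareDispersion 1 0 x - μ)
        ((Crystal.cubic 2).fermiSurfaceRep (fun x : Momentum => squareDispersion 1 0 x - μ)) a →
      (∀ θ, antipodeAngularDeriv (fun q : Momentum => squareDispersion 1 0 q - μ) a Θ θ = 1) ∧
        ¬ HypA4' (fun q : Momentum => squareDispersion 1 0 q - μ) a Θ :=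
  ⟨klfs_hypSy μ, klfs_hypA4 hμ₂, klfs_nonempty_fermiCurveParam hμ₁ hμ₂, ⟨fun p => -p, klfs_isAntipodalMapOn_neg hμ₂⟩,
    fun Θ _ ha => ⟨klfs_antipodeAngularDeriv_eq_one hμ₁ hμ₂ Θ ha, klfs_not_hypA4' hμ₁ hμ₂ Θ ha⟩⟩

/-- **On the programme's windows** (doping window of record `[-0.4275, -0.1775]`, analysis window `[-1, -0.15]`, extended
certificate window `[-0.5725, -0.075]`, covariance window `klWindowC = [-1.05, -0.15]`): `∂a/∂θ ≡ 1` and (A4′) fails for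
every angular coordinate and every antipodal map. [folklore] -/
theorem klfs_windows_not_hypA4' {μ : ℝ}
    (hμ : μ ∈ Icc (-0.4275 : ℝ) (-0.1775) ∨ μ ∈ Icc (-1 : ℝ) (-0.15) ∨ μ ∈ Icc (-0.5725 : ℝ) (-0.075) ∨
      μ ∈ Icc (-1.05 : ℝ) (-0.15))
    (Θ : FermiCurveParam (Crystal.cubic 2) (fun q : Momentum => squareDispersion 1 0 q - μ)) {a : Momentum → Momentum}
    (ha : IsAntipodalMapOn (fun x : Momentum => squareDispersion 1 0 x - μ)
      ((Crystal.cubic 2).fermiSurfaceRep (fun x : Momentum => squareDispersion 1 0 x - μ)) a) :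
    (∀ θ, antipodeAngularDeriv (fun q : Momentum => squareDispersion 1 0 q - μ) a Θ θ = 1) ∧
      ¬ HypA4' (fun q : Momentum => squareDispersion 1 0 q - μ) a Θ := by
  have hμ₁ : -4 < μ := by rcases hμ with h | h | h | h <;> linarith [h.1]
  have hμ₂ : μ < 0 := by rcases hμ with h | h | h | h <;> linarith [h.2]
  exact ⟨klfs_antipodeAngularDeriv_eq_one hμ₁ hμ₂ Θ ha, klfs_not_hypA4' hμ₁ hμ₂ Θ ha⟩

end Summit.HubbardSuperconductivity.HubbardSuperconductivity.Theorems

end
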